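import Summits.ResolutionOfSingularities.ResolutionOfSingularities.Theorems.WeightedInvariantIotaFlatTTorusFactorOfTauEssSmooth
import Summits.ResolutionOfSingularities.ResolutionOfSingularities.Theorems.WeightedInvariantIota3SigmaFlagSpecialise
import HarnessLib

/-!
# hc10 `IotaTorusFactorMonotoneLE 3 p ι₃ᵗ` needs the σ generic-fibre inequality `hσ` ONLY IN THE DOOR SETTING, and there ONLY AT FINITE RESIDUE FIELDS
# (door `HypersurfaceCentreConstruction`, stmt-ResolutionOfSingularities-19897; registered stub `stub_keyRungGrHomLE_three`, gap `hσ`; audit glue)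

Topic: `Summits/ResolutionOfSingularities/ResolutionOfSingularities/Theorems`. Helper for the door item `HypersurfaceCentreConstruction`
(stmt-ResolutionOfSingularities-19897, route `WeightedInvariant`), line `local-engine` (skeleton v3.12 `7a4b52ef`), def-free.

The clause (c10)≤3 `IotaTorusFactorMonotoneLE 3 p ι` is DOOR-TYPED: its positions `(S, f)` are regular local rings essentially of finite type over a
PERFECT FIELD `k₀` OF CHARACTERISTIC `p`.  The assembly of record `Iota3.iotaFlatT_torusFactor_le` (…ContactCylinderTorusFactorFlatT)
consumes the σ-input `hσ` («`σ(T(X), g) ≤ σ(T, g)` at the generic fibre point `T → T(X) = T[X]_{𝔪T[X]}`») at ONE ring only: `T = S_P`, the local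
ring of `S` at the generic prime `P` of the top `ι₀`-stratum — again essentially of finite type over `k₀`.  Hence:

* §1 **`Iota3.iotaFlatT_torusFactorMonotoneLE_of_door`** — (c10)≤3 for `ι₃ᵗ` from `h10τ`, `hgenτ` and the DOOR-TYPED `hσ`
  (`T` regular local, essentially of finite type over a perfect field of characteristic `p`, `dim T ≤ 3`); the proof is that of
  `Iota3.iotaFlatT_torusFactor_le` verbatim with `hσ` instantiated at `S_P` (`Algebra.EssFiniteType.comp k₀ S S_P`).
* §2 **`Iota3.sigma_genericFibre_le_door_of_finite`** — the door-typed `hσ` is needed ONLY at FINITE residue fields: at an infinite residue field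
  `σ(T(X), g) = σ(T, g)` (`Iota3.iotaSigma_genericFibre_eq`, …Iota3SigmaFlagSpecialise p542470).  (A regular local ring essentially of finite type
  over `k₀` with finite residue field forces `k₀` finite: the residual of `hσ` is «closed points of threefolds over FINITE fields», an `𝔽_p`-algebra
  setting where the Galois route …Iota3SigmaGenericFibreFinite (`S ⊗_{𝔽_p} 𝔽_{pⁿ}`, dominated descent modulo (J-can)+(EX)) is typed.)
* §3 **`Iota3.iotaFlatT_torusFactorMonotoneLE_of_tauEssSmooth_door`** — hc10 ⟸ (c11τ)≤3 ∧ `hσdoorfin` (as `…_of_tauEssSmooth`, p811769, with the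
  σ-input in its door-typed finite-residue-field form).

[OURS · L1 W4.3 · audit glue]  Replaces the role of NO printed item; NOT a statement of the manuscript under review [claim: Hironaka2017, status:
under-review]; candidates stay candidates; AI work, weaker than expert review.  No definition; no axiom; every input is a hypothesis.

## References

* H. Matsumura, *Commutative Ring Theory* (1987), Thm. 4.3, §5, §8. [Matsumura1987]
* H. Hironaka, *Characteristic polyhedra of singularities*, J. Math. Kyoto Univ. 7 (1967), §3. [Hironaka1967]
-/

noncomputable section

open IsLocalRing Literature.AlgebraicGeometry.Resolution Polynomial
open Summit.ResolutionOfSingularities.ResolutionOfSingularities.Theorems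
open Summit.ResolutionOfSingularities.ResolutionOfSingularities.Theorems.ContactCylinder

set_option linter.dupNamespace false -- mandated namespace `Summit.<Summit>.<Problem>` of this single-conjunct summit

namespace Summit.ResolutionOfSingularities.ResolutionOfSingularities.Cruxes.HypersurfaceCentreConstruction.LocalEngine

namespace Iota3

/-! ## §1 (c10)≤3 for `ι₃ᵗ` with the σ-input in the door setting -/

/-- **(c10)≤3 FOR `ι₃ᵗ` MODULO `h10τ`, `hgenτ` AND THE DOOR-TYPED `hσ`**: `IotaTorusFactorMonotoneLE 3 p Iota3.iotaFlatT`, where the σ generic-fibre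
inequality is assumed only for regular local rings `T` essentially of finite type over a perfect field of characteristic `p` with `dim T ≤ 3`
(the proof of `Iota3.iotaFlatT_torusFactor_le`, with `hσ` read at `S_P`). [OURS · (c10)≤3 ⟸ h10τ ∧ hgenτ ∧ hσ-door] -/
theorem iotaFlatT_torusFactorMonotoneLE_of_door (p : ℕ)
    (h10τ : ∀ (T : Type) [CommRing T] [IsRegularLocalRing T] (g : T) (𝔮₁ : Ideal T[X]) [𝔮₁.IsPrime],
      ringKrullDim T ≤ 3 → 𝔮₁.comap (C : T →+* T[X]) = maximalIdeal T →
      iotaOrdEpsTau (Localization.AtPrime 𝔮₁) (algebraMap T[X] (Localization.AtPrime 𝔮₁) (C g)) ≤ iotaOrdEpsTau T g)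
    (hgenτ : ∀ (T : Type) [CommRing T] [IsRegularLocalRing T] (g : T)
      [((maximalIdeal T).map (C : T →+* T[X])).IsPrime], ringKrullDim T ≤ 3 →
      iotaOrdEpsTau (Localization.AtPrime ((maximalIdeal T).map (C : T →+* T[X])))
        (algebraMap T[X] (Localization.AtPrime ((maximalIdeal T).map (C : T →+* T[X]))) (C g)) = iotaOrdEpsTau T g)
    (hσ : ∀ (k₀ : Type) [Field k₀] [CharP k₀ p] [PerfectField k₀]
      (T : Type) [CommRing T] [Algebra k₀ T] [Algebra.EssFiniteType k₀ T] [IsRegularLocalRing T] (g : T)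
      [((maximalIdeal T).map (C : T →+* T[X])).IsPrime], ringKrullDim T ≤ 3 →
      iotaSigma (Localization.AtPrime ((maximalIdeal T).map (C : T →+* T[X])))
        (algebraMap T[X] (Localization.AtPrime ((maximalIdeal T).map (C : T →+* T[X]))) (C g)) ≤ iotaSigma T g) :
    IotaTorusFactorMonotoneLE 3 p iotaFlatT := by
  intro k₀ _ _ _ S _ _ _ _ f 𝔮 _ hdim h𝔮
  haveI := isDomain_of_isRegularLocalRing S
  haveI : IsRegularRing S := isRegularRing_of_isRegularLocalRing S
  have hdimT : ∀ (𝔭 : Ideal S) [𝔭.IsPrime], ringKrullDim (Localization.AtPrime 𝔭) ≤ 3 := fun 𝔭 _ =>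
    (ringKrullDim_localization_atPrime_le 𝔭).trans hdim
  have h10 : iotaOrdEpsTau (Localization.AtPrime 𝔮) (algebraMap S[X] (Localization.AtPrime 𝔮) (C f)) ≤
      iotaOrdEpsTau S f := h10τ S f 𝔮 hdim h𝔮
  have hb : IotaBoundedBy ((Ordinal.omega0 + 1) * Ordinal.omega0) (iotaCylinder iotaOrdEpsTau iotaSigma) :=
    iotaBoundedBy_iotaCylinder iotaSigma_boundedBy
  have key : ∀ (P : Ideal S) [P.IsPrime], topStratum iotaOrdEpsTau S f = {𝔮₀ | P ≤ 𝔮₀.asIdeal} →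
      iotaFlatT (Localization.AtPrime 𝔮) (algebraMap S[X] (Localization.AtPrime 𝔮) (C f)) ≤ iotaFlatT S f := by
    intro P _ hE
    have hP𝔮 : P.map (C : S →+* S[X]) ≤ 𝔮 := by
      rw [Ideal.map_le_iff_le_comap, h𝔮]
      exact IsLocalRing.le_maximalIdeal (Ideal.IsPrime.ne_top ‹_›)
    -- the ONE use of `hσ`: at `S_P`, essentially of finite type over `k₀`
    haveI : Algebra.EssFiniteType k₀ (Localization.AtPrime P) := Algebra.EssFiniteType.comp k₀ S (Localization.AtPrime P)
    have hσ' : iotaSigma (Localization.AtPrime (P.map (C : S →+* S[X]))) (algebraMap S[X] _ (C f)) ≤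
        iotaSigma (Localization.AtPrime P) (algebraMap S (Localization.AtPrime P) f) := by
      obtain ⟨_, h1⟩ := iota_atPrime_map_C_eq_of_generic iotaSigma_isoInvariant S f P
      rw [h1]
      exact hσ k₀ (Localization.AtPrime P) (algebraMap S (Localization.AtPrime P) f) (hdimT P)
    have hE' : iotaOrdEpsTau (Localization.AtPrime 𝔮) (algebraMap S[X] (Localization.AtPrime 𝔮) (C f)) =
        iotaOrdEpsTau S f →
        topStratum iotaOrdEpsTau (Localization.AtPrime 𝔮) (algebraMap S[X] (Localization.AtPrime 𝔮) (C f)) =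
          {𝔮'' | (P.map (C : S →+* S[X])).map (algebraMap S[X] (Localization.AtPrime 𝔮)) ≤ 𝔮''.asIdeal} := by
      intro heq
      refine topStratum_torusFactor_of_eq iotaOrdEpsTau_isoInvariant S f P hE 𝔮 heq ?_ ?_ ?_ ?_ ?_
      · intro _
        obtain ⟨_, h1⟩ := iota_atPrime_map_C_eq_of_generic iotaOrdEpsTau_isoInvariant S f P
        rw [h1]
        exact hgenτ (Localization.AtPrime P) (algebraMap S (Localization.AtPrime P) f) (hdimT P)
      · intro 𝔮' _ h𝔮'
        exact iota_atPrime_le_of_le iotaOrdEpsTau_isoInvariant iotaOrdEpsTau_generizationMonotone S[X] 𝔮' 𝔮 h𝔮' (C f)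
      · intro 𝔮' _ _ hle
        exact iota_atPrime_le_of_le iotaOrdEpsTau_isoInvariant iotaOrdEpsTau_generizationMonotone S[X] _ 𝔮' hle (C f)
      · intro 𝔮' _ _
        obtain ⟨𝔮₁, h𝔮₁, hmax, -, Φ, hΦ⟩ :=
          exists_ringEquiv_atPrime_polynomial S f 𝔮' (𝔮'.comap (C : S →+* S[X])) rfl
        rw [← iota_ringEquiv_atPrime (𝔫 := 𝔮') (𝔫' := 𝔮₁) iotaOrdEpsTau_isoInvariant Φ, hΦ]
        exact h10τ (Localization.AtPrime (𝔮'.comap (C : S →+* S[X]))) _ 𝔮₁ (hdimT _) hmax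
      · intro 𝔭 _
        exact iotaOrdEpsTau_generizationMonotone S 𝔭 f
    unfold iotaFlatT
    exact iotaLex_iotaCylinder_torusFactor_le iotaSigma_isoInvariant hb S f P hE 𝔮 hP𝔮 h10 hE' hσ'
  by_cases hf0 : f = 0
  · subst hf0
    exact key ⊥ (topStratum_iotaOrdEpsTau_zero_eq_bot S hdim)
  by_cases hfu : IsUnit f
  · exact key ⊥ (topStratum_iotaOrdEpsTau_of_isUnit_eq_bot S hdim hfu)
  · have hf : f ∈ maximalIdeal S := (IsLocalRing.mem_maximalIdeal f).mpr (mem_nonunits_iff.mpr hfu)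
    obtain ⟨P, hP, -, -, hE⟩ := topStratum_iotaOrdEpsTau_eq hdim hf0 hf
    haveI := hP
    exact key P hE

/-! ## §2 The door-typed `hσ` is needed only at finite residue fields -/

/-- **THE DOOR-TYPED `hσ` ⟸ ITS FINITE-RESIDUE-FIELD CASE**: at an infinite residue field `σ(T(X), g) = σ(T, g)` (`iotaSigma_genericFibre_eq`).
[OURS · audit glue] -/
theorem sigma_genericFibre_le_door_of_finite (p : ℕ)
    (hσfin : ∀ (k₀ : Type) [Field k₀] [CharP k₀ p] [PerfectField k₀]
      (T : Type) [CommRing T] [Algebra k₀ T] [Algebra.EssFiniteType k₀ T] [IsRegularLocalRing T] (g : T)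
      [((maximalIdeal T).map (C : T →+* T[X])).IsPrime], Finite (ResidueField T) → ringKrullDim T ≤ 3 →
      iotaSigma (Localization.AtPrime ((maximalIdeal T).map (C : T →+* T[X])))
        (algebraMap T[X] (Localization.AtPrime ((maximalIdeal T).map (C : T →+* T[X]))) (C g)) ≤ iotaSigma T g) :
    ∀ (k₀ : Type) [Field k₀] [CharP k₀ p] [PerfectField k₀]
      (T : Type) [CommRing T] [Algebra k₀ T] [Algebra.EssFiniteType k₀ T] [IsRegularLocalRing T] (g : T)
      [((maximalIdeal T).map (C : T →+* T[X])).IsPrime], ringKrullDim T ≤ 3 →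
      iotaSigma (Localization.AtPrime ((maximalIdeal T).map (C : T →+* T[X])))
        (algebraMap T[X] (Localization.AtPrime ((maximalIdeal T).map (C : T →+* T[X]))) (C g)) ≤ iotaSigma T g := by
  intro k₀ _ _ _ T _ _ _ _ g _ hd
  rcases finite_or_infinite (ResidueField T) with hfin | hinf
  · exact hσfin k₀ T g hfin hd
  · exact (iotaSigma_genericFibre_eq g).le

/-! ## §3 hc10 ⟸ (c11τ)≤3 ∧ the door-typed finite-residue-field `hσ` -/

/-- **THE GAP hc10 OF THE P3 RUNG MODULO (c11τ)≤3 AND THE DOOR-TYPED FINITE-RESIDUE-FIELD `hσ`**: `IotaTorusFactorMonotoneLE 3 p Iota3.iotaFlatT`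
(`Iota3.iotaFlatT_torusFactorMonotoneLE_of_tauEssSmooth` with its σ-input narrowed twice: door setting, §1; finite residue fields, §2).
[OURS · hc10 ⟸ (c11τ)≤3 ∧ hσ-door-finite] -/
theorem iotaFlatT_torusFactorMonotoneLE_of_tauEssSmooth_door (p : ℕ)
    (hτ : ∀ (T T' : Type) [CommRing T] [IsRegularLocalRing T] [CommRing T'] [IsRegularLocalRing T'] [Algebra T T']
      [IsLocalHom (algebraMap T T')] [Algebra.FormallySmooth T T'] [Algebra.EssFiniteType T T'] (g : T),
      ringKrullDim T' ≤ 3 → iotaTau T' (algebraMap T T' g) = iotaTau T g)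
    (hσfin : ∀ (k₀ : Type) [Field k₀] [CharP k₀ p] [PerfectField k₀]
      (T : Type) [CommRing T] [Algebra k₀ T] [Algebra.EssFiniteType k₀ T] [IsRegularLocalRing T] (g : T)
      [((maximalIdeal T).map (C : T →+* T[X])).IsPrime], Finite (ResidueField T) → ringKrullDim T ≤ 3 →
      iotaSigma (Localization.AtPrime ((maximalIdeal T).map (C : T →+* T[X])))
        (algebraMap T[X] (Localization.AtPrime ((maximalIdeal T).map (C : T →+* T[X]))) (C g)) ≤ iotaSigma T g) :
    IotaTorusFactorMonotoneLE 3 p iotaFlatT :=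
  iotaFlatT_torusFactorMonotoneLE_of_door p
    (fun T _ _ g 𝔮₁ _ hd h𝔮₁ => iotaOrdEpsTau_torusFactor_le_of_tauEssSmooth hτ T g 𝔮₁ hd h𝔮₁)
    (fun T _ _ g _ hd => iotaOrdEpsTau_genericFibre_eq_of_tauEssSmooth hτ T g hd) (sigma_genericFibre_le_door_of_finite p hσfin)

end Iota3

end Summit.ResolutionOfSingularities.ResolutionOfSingularities.Cruxes.HypersurfaceCentreConstruction.LocalEngine

end
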